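import Summits.AnomalousDissipation.AnomalousDissipation.Theorems.QuarticGate.Negative.LevelOne
import Mathlib.Algebra.MvPolynomial.Funext

/-!
# Fourier dictionary for the axial Casimir stubs (line `axis-sectors` of crux `MomentParity.QuarticGate`), part 3

Self-contained part (imports only `Negative/LevelOne`; independent of parts 1–2) of the dictionary
for the stubs `stub_axialQuadRigidity` / `stub_noAxialCubicCasimir` of line `axis-sectors`:

* (D6) MULTILINEAR EXTRACTION: a real polynomial vanishing on `ℝ^σ` is zero
  (`eq_zero_of_forall_eval_eq_zero`, `coeff_eq_zero_of_forall_eval_eq_zero` — Mathlib's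
  `MvPolynomial.funext`), and the monomial-sum form `forall_coeff_eq_zero_of_forall_sum_monomial_eq_zero`.
* (D7) THE FINITE SHEAR GROUP `H_L = {a : T³ | a 1 = 0, L • a = 0}`: it is the grid
  `{(j₀/L, 0, j₂/L) : j ∈ Fin L × Fin L}` (`shearGrid_iff`, `shearGrid_injective`), the characters on it
  (`mFourier_shearGrid`), the character sums `Σ_{j<L} e^{2πi n j/L} = L·[L ∣ n]` (`sum_exp_two_pi_mul_div`),
  `Σ_{a ∈ H_L} e_k(a) = L²·[L ∣ k₀ ∧ L ∣ k₂]` (`sum_mFourier_shearGrid`) and its NYQUIST form for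
  `|k₀|, |k₂| < L` (`sum_mFourier_shearGrid_of_abs_lt`: only axial frequencies `(0, k₁, 0)` survive).
* (D5) ONE-VARIABLE BOOKKEEPING for the momentum split along `e₁`: coordinates in the ball are
  bounded (`abs_apply_le_of_mem_freqBall`), the characters of the `y`-shift `(0, s, 0)`
  (`mFourier_single_one`, `neg_single_one`), and FINITE FOURIER UNIQUENESS on the circle
  (`eq_zero_of_forall_sum_mul_exp_eq_zero`: `Σ_{m∈T} γ_m e^{2πi m s} = 0 ∀ s : ℝ ⇒ γ = 0 on T`), so that
  the momentum-`m` components of an identity holding along all `y`-translates vanish separately.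
-/

namespace Summit.AnomalousDissipation.AnomalousDissipation.Theorems.MomentParityQuarticGate

open MeasureTheory Filter
open scoped InnerProductSpace RealInnerProductSpace ComplexConjugate ENNReal
open Literature.Analysis.FunctionSpaces Literature.Analysis.FluidPDE
open Summit.AnomalousDissipation.AnomalousDissipation.Theses.MomentParity
open Summit.AnomalousDissipation.AnomalousDissipation.Theorems.QuarticGate.Negative

-- `Summit.<Summit>.<Problem>` is the tree's mandated summit-side namespace (CONVENTIONS §2); for this
-- single-conjunct summit the two coincide, so the duplicate is deliberate.
set_option linter.dupNamespace false

noncomputable section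

/-! ## D6 — multilinear extraction -/

section Extraction

/-- **D6 — a real polynomial that vanishes identically is zero** (Mathlib `MvPolynomial.funext`,
`ℝ` infinite). [folklore] -/
theorem eq_zero_of_forall_eval_eq_zero {σ : Type*} (Q : MvPolynomial σ ℝ)
    (h : ∀ x : σ → ℝ, MvPolynomial.eval x Q = 0) : Q = 0 :=
  MvPolynomial.funext fun x => by rw [h x, map_zero]

/-- **D6 — coefficient extraction**: every coefficient of an identically vanishing real polynomial
vanishes. [folklore] -/
theorem coeff_eq_zero_of_forall_eval_eq_zero {σ : Type*} (Q : MvPolynomial σ ℝ)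
    (h : ∀ x : σ → ℝ, MvPolynomial.eval x Q = 0) (e : σ →₀ ℕ) : Q.coeff e = 0 := by
  rw [eq_zero_of_forall_eval_eq_zero Q h, MvPolynomial.coeff_zero]

/-- Two real polynomials with the same values have the same coefficients. [folklore] -/
theorem coeff_eq_coeff_of_forall_eval_eq {σ : Type*} (Q R : MvPolynomial σ ℝ)
    (h : ∀ x : σ → ℝ, MvPolynomial.eval x Q = MvPolynomial.eval x R) (e : σ →₀ ℕ) :
    Q.coeff e = R.coeff e := by
  rw [MvPolynomial.funext h]

/-- **D6 — homogeneous-scaling / monomial form**: if `Σ_{e ∈ E} a_e t^e = 0` for all `t ∈ ℝ^σ`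
(`t^e = Πᵢ tᵢ^{eᵢ}`, `E` a finite set of multi-exponents) then every `a_e = 0`. [folklore] -/
theorem forall_coeff_eq_zero_of_forall_sum_monomial_eq_zero {σ : Type*} (E : Finset (σ →₀ ℕ))
    (a : (σ →₀ ℕ) → ℝ)
    (h : ∀ t : σ → ℝ, ∑ e ∈ E, a e * e.prod (fun i n => t i ^ n) = 0) :
    ∀ e ∈ E, a e = 0 := by
  classical
  intro e he
  set Q : MvPolynomial σ ℝ := ∑ e ∈ E, MvPolynomial.monomial e (a e) with hQ
  have hQ0 : Q = 0 := eq_zero_of_forall_eval_eq_zero Q fun t => by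
    rw [hQ, map_sum]
    simp only [MvPolynomial.eval_monomial]
    exact h t
  have hc : Q.coeff e = a e := by
    rw [hQ, MvPolynomial.coeff_sum]
    simp only [MvPolynomial.coeff_monomial]
    rw [Finset.sum_ite_eq', if_pos he]
  rw [← hc, hQ0, MvPolynomial.coeff_zero]

end Extraction

/-! ## D7 — the finite shear group `H_L` and its character sums (Nyquist bookkeeping) -/

section ShearGrid

/-- **`L`-torsion of the circle**: `L • x = 0 ↔ x = j/L` for some `j < L` (`0 < L`). [folklore] -/
theorem nsmul_eq_zero_iff_exists_fin {L : ℕ} (hL : 0 < L) (x : UnitAddCircle) :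
    L • x = 0 ↔ ∃ j : Fin L, x = ((((j : ℕ) : ℝ) / L : ℝ) : UnitAddCircle) := by
  rw [AddCircle.nsmul_eq_zero_iff hL]
  constructor
  · rintro ⟨m, hm, rfl⟩
    exact ⟨⟨m, hm⟩, by rw [mul_one]⟩
  · rintro ⟨j, rfl⟩
    exact ⟨j, j.2, by rw [mul_one]⟩

/-- **D7(a) — the finite shear group is the grid `H_L = {(j₀/L, 0, j₂/L)}`**: for `0 < L`,
`a 1 = 0 ∧ L • a = 0 ↔ a = (j₀/L, 0, j₂/L)` for some `j ∈ Fin L × Fin L`. [folklore] -/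
theorem shearGrid_iff {L : ℕ} (hL : 0 < L) (a : UnitAddTorus (Fin 3)) :
    (a 1 = 0 ∧ L • a = 0) ↔ ∃ j : Fin L × Fin L,
      a = fun i => ((((![(j.1 : ℕ), 0, (j.2 : ℕ)] : Fin 3 → ℕ) i : ℝ) / L : ℝ) : UnitAddCircle) := by
  constructor
  · rintro ⟨h1, hLa⟩
    obtain ⟨j0, hj0⟩ := (nsmul_eq_zero_iff_exists_fin hL (a 0)).1 (by simpa using congr_fun hLa 0)
    obtain ⟨j2, hj2⟩ := (nsmul_eq_zero_iff_exists_fin hL (a 2)).1 (by simpa using congr_fun hLa 2)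
    refine ⟨(j0, j2), funext fun i => ?_⟩
    fin_cases i
    · simpa using hj0
    · simp [h1]
    · simpa using hj2
  · rintro ⟨j, rfl⟩
    refine ⟨by simp, funext fun i => ?_⟩
    fin_cases i
    · simpa using (nsmul_eq_zero_iff_exists_fin hL _).2 ⟨j.1, rfl⟩
    · simp
    · simpa using (nsmul_eq_zero_iff_exists_fin hL _).2 ⟨j.2, rfl⟩

/-- The grid parametrisation `j ↦ (j₀/L, 0, j₂/L)` of `H_L` is injective. [folklore] -/
theorem shearGrid_injective {L : ℕ} (hL : 0 < L) :
    Function.Injective fun j : Fin L × Fin L => (fun i => ((((![(j.1 : ℕ), 0, (j.2 : ℕ)] : Fin 3 → ℕ) i : ℝ)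
      / L : ℝ) : UnitAddCircle) : UnitAddTorus (Fin 3)) := by
  have hLr : (0 : ℝ) < L := Nat.cast_pos.2 hL
  have hmem : ∀ j : Fin L, ((j : ℕ) : ℝ) / L ∈ Set.Ico (0 : ℝ) (0 + 1) := fun j => by
    rw [zero_add, Set.mem_Ico]
    exact ⟨div_nonneg (Nat.cast_nonneg _) hLr.le, (div_lt_one hLr).2 (by exact_mod_cast j.2)⟩
  have hinj : ∀ j j' : Fin L, (((((j : ℕ) : ℝ) / L : ℝ)) : UnitAddCircle) = ((((j' : ℕ) : ℝ) / L : ℝ)) →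
      j = j' := fun j j' h => by
    have h1 := (AddCircle.coe_eq_coe_iff_of_mem_Ico (hmem j) (hmem j')).1 h
    have h2 : ((j : ℕ) : ℝ) = (j' : ℕ) := by
      have := congrArg (· * (L : ℝ)) h1
      simpa [div_mul_cancel₀, hLr.ne'] using this
    exact Fin.ext (by exact_mod_cast h2)
  intro j j' h
  have h0 := congr_fun h 0
  have h2 := congr_fun h 2
  simp only [Matrix.cons_val_zero, Matrix.cons_val_two, Matrix.tail_cons, Matrix.head_cons] at h0 h2
  exact Prod.ext (hinj _ _ h0) (hinj _ _ h2)

/-- **Characters on the grid**: `e_k(j₀/L, 0, j₂/L) = exp(2πi k₀ j₀ / L) exp(2πi k₂ j₂ / L)`. [folklore] -/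
theorem mFourier_shearGrid {L : ℕ} (k : Fin 3 → ℤ) (j : Fin L × Fin L) :
    (UnitAddTorus.mFourier k (fun i => ((((![(j.1 : ℕ), 0, (j.2 : ℕ)] : Fin 3 → ℕ) i : ℝ) / L : ℝ) :
        UnitAddCircle)) : ℂ) =
      Complex.exp (2 * Real.pi * Complex.I * (k 0) * ((j.1 : ℕ) : ℝ) / L) *
        Complex.exp (2 * Real.pi * Complex.I * (k 2) * ((j.2 : ℕ) : ℝ) / L) := by
  simp only [UnitAddTorus.mFourier, ContinuousMap.coe_mk, Fin.prod_univ_three, Matrix.cons_val_zero,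
    Matrix.cons_val_one, Matrix.cons_val_two, Matrix.tail_cons, Matrix.head_cons, fourier_coe_apply,
    Nat.cast_zero, zero_div]
  simp only [Complex.ofReal_zero, mul_zero, Complex.exp_zero, mul_one, Complex.ofReal_div,
    Complex.ofReal_natCast, Complex.ofReal_one, div_one, mul_div_assoc]

/-- **D7(b) — character sums over `ℤ/L`**: `Σ_{j < L} exp(2πi n j / L) = L` if `L ∣ n`, else `0`. [folklore] -/
theorem sum_exp_two_pi_mul_div {L : ℕ} (hL : 0 < L) (n : ℤ) :
    ∑ j : Fin L, Complex.exp (2 * Real.pi * Complex.I * n * ((j : ℕ) : ℝ) / L) =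
      if (L : ℤ) ∣ n then (L : ℂ) else 0 := by
  set ζ : ℂ := Complex.exp (2 * Real.pi * Complex.I * n / L) with hζ
  have hL0 : (L : ℂ) ≠ 0 := Nat.cast_ne_zero.2 hL.ne'
  have h2pi : (2 * Real.pi * Complex.I : ℂ) ≠ 0 := by simp [Real.pi_ne_zero, Complex.I_ne_zero]
  have hterm : ∀ j : ℕ, Complex.exp (2 * Real.pi * Complex.I * n * ((j : ℕ) : ℝ) / L) = ζ ^ j := fun j => by
    rw [hζ, ← Complex.exp_nat_mul]
    congr 1
    push_cast
    ring
  have hsum : ∑ j : Fin L, Complex.exp (2 * Real.pi * Complex.I * n * ((j : ℕ) : ℝ) / L) =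
      ∑ j ∈ Finset.range L, ζ ^ j := by
    rw [Fin.sum_univ_eq_sum_range (fun j => Complex.exp (2 * Real.pi * Complex.I * n * ((j : ℕ) : ℝ) / L)) L]
    exact Finset.sum_congr rfl fun j _ => hterm j
  rw [hsum]
  have hζL : ζ ^ L = 1 := by
    rw [hζ, ← Complex.exp_nat_mul, show (L : ℂ) * (2 * Real.pi * Complex.I * n / L) =
      n * (2 * Real.pi * Complex.I) by field_simp]
    exact Complex.exp_int_mul_two_pi_mul_I n
  split_ifs with hdvd
  · obtain ⟨q, hq⟩ := hdvd
    have hζ1 : ζ = 1 := by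
      rw [hζ, hq, show (2 * Real.pi * Complex.I * (((L : ℤ) * q : ℤ) : ℂ) / L) = q * (2 * Real.pi * Complex.I) by
        push_cast; field_simp]
      exact Complex.exp_int_mul_two_pi_mul_I q
    simp [hζ1]
  · have hζ1 : ζ ≠ 1 := fun h1 => hdvd (by
      rw [hζ, Complex.exp_eq_one_iff] at h1
      obtain ⟨m, hm⟩ := h1
      have key : (n : ℂ) = ((L * m : ℤ) : ℂ) := by
        field_simp at hm
        push_cast
        linear_combination hm
      exact ⟨m, by exact_mod_cast key⟩)
    rw [geom_sum_eq hζ1, hζL, sub_self, zero_div]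

/-- **D7(b) — character sums over the shear grid**:
`Σ_{j ∈ Fin L × Fin L} e_k(j₀/L, 0, j₂/L) = L²` if `L ∣ k₀` and `L ∣ k₂`, else `0`. [folklore] -/
theorem sum_mFourier_shearGrid {L : ℕ} (hL : 0 < L) (k : Fin 3 → ℤ) :
    ∑ j : Fin L × Fin L, (UnitAddTorus.mFourier k (fun i => ((((![(j.1 : ℕ), 0, (j.2 : ℕ)] : Fin 3 → ℕ) i : ℝ)
      / L : ℝ) : UnitAddCircle)) : ℂ) =
      if (L : ℤ) ∣ k 0 ∧ (L : ℤ) ∣ k 2 then ((L : ℂ)) ^ 2 else 0 := by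
  simp_rw [mFourier_shearGrid]
  rw [Fintype.sum_prod_type]
  dsimp only
  rw [← Finset.sum_mul_sum, sum_exp_two_pi_mul_div hL, sum_exp_two_pi_mul_div hL]
  by_cases h0 : (L : ℤ) ∣ k 0 <;> by_cases h2 : (L : ℤ) ∣ k 2 <;> simp [h0, h2, sq]

/-- **D7(c) — Nyquist**: a multiple of `L` of absolute value `< L` is zero. [folklore] -/
theorem eq_zero_of_dvd_of_abs_lt {L : ℕ} {n : ℤ} (hdvd : (L : ℤ) ∣ n) (hlt : |n| < L) : n = 0 :=
  Int.eq_zero_of_abs_lt_dvd hdvd hlt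

/-- **D7 — character sums below the Nyquist frequency**: if `|k₀|, |k₂| < L` then
`Σ_{a ∈ H_L} e_k(a) = L²` if `k₀ = k₂ = 0` (an axial frequency `k = (0, k₁, 0)`), else `0`. [folklore] -/
theorem sum_mFourier_shearGrid_of_abs_lt {L : ℕ} (hL : 0 < L) (k : Fin 3 → ℤ) (h0 : |k 0| < L)
    (h2 : |k 2| < L) :
    ∑ j : Fin L × Fin L, (UnitAddTorus.mFourier k (fun i => ((((![(j.1 : ℕ), 0, (j.2 : ℕ)] : Fin 3 → ℕ) i : ℝ)
      / L : ℝ) : UnitAddCircle)) : ℂ) =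
      if k 0 = 0 ∧ k 2 = 0 then ((L : ℂ)) ^ 2 else 0 := by
  rw [sum_mFourier_shearGrid hL]
  have e0 : (L : ℤ) ∣ k 0 ↔ k 0 = 0 := ⟨fun h => Int.eq_zero_of_abs_lt_dvd h h0, fun h => h ▸ dvd_zero _⟩
  have e2 : (L : ℤ) ∣ k 2 ↔ k 2 = 0 := ⟨fun h => Int.eq_zero_of_abs_lt_dvd h h2, fun h => h ▸ dvd_zero _⟩
  simp only [e0, e2]

end ShearGrid

/-! ## D5 — one-variable bookkeeping for the momentum split along `e₁` -/

section Axis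

/-- Coordinates of a frequency in the ball of radius `N` are bounded by `N`. [folklore] -/
theorem abs_apply_le_of_mem_freqBall {N : ℕ} {k : Fin 3 → ℤ} (hk : k ∈ Torus.freqBall N) (i : Fin 3) :
    |k i| ≤ N := by
  have h := Torus.mem_freqBall.1 hk
  have hi : ((k i : ℝ)) ^ 2 ≤ (N : ℝ) ^ 2 :=
    (Finset.single_le_sum (f := fun j => ((k j : ℝ)) ^ 2) (fun _ _ => sq_nonneg _) (Finset.mem_univ i)).trans h
  have habs : |(k i : ℝ)| ≤ N := abs_le_of_sq_le_sq' hi (Nat.cast_nonneg N) |> fun h2 => abs_le.2 h2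
  have : ((|k i| : ℤ) : ℝ) ≤ N := by rw [Int.cast_abs]; exact habs
  exact_mod_cast this

/-- **Characters of the `y`-shift**: `e_k(0, s, 0) = exp(2πi k₁ s)`. [folklore] -/
theorem mFourier_single_one (k : Fin 3 → ℤ) (s : ℝ) :
    (UnitAddTorus.mFourier k (Pi.single (1 : Fin 3) ((s : ℝ) : UnitAddCircle)) : ℂ) =
      Complex.exp (2 * Real.pi * Complex.I * (k 1) * s) := by
  simp only [UnitAddTorus.mFourier, ContinuousMap.coe_mk, Fin.prod_univ_three]
  rw [Pi.single_eq_of_ne (by decide : (0 : Fin 3) ≠ 1), Pi.single_eq_same,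
    Pi.single_eq_of_ne (by decide : (2 : Fin 3) ≠ 1), fourier_eval_zero, fourier_eval_zero, one_mul, mul_one,
    fourier_coe_apply, Complex.ofReal_one, div_one]

/-- The inverse `y`-shift: `-(0, s, 0) = (0, -s, 0)`. [folklore] -/
theorem neg_single_one (s : ℝ) :
    -(Pi.single (1 : Fin 3) ((s : ℝ) : UnitAddCircle) : UnitAddTorus (Fin 3)) =
      Pi.single (1 : Fin 3) (((-s : ℝ)) : UnitAddCircle) := by
  rw [← Pi.single_neg, AddCircle.coe_neg]

/-- The `y`-shifts lie in no shear direction: `(0, s, 0) 0 = 0` and `(0, s, 0) 2 = 0`, `(0, s, 0) 1 = s`. [folklore] -/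
theorem single_one_apply (s : ℝ) :
    (Pi.single (1 : Fin 3) ((s : ℝ) : UnitAddCircle) : UnitAddTorus (Fin 3)) 0 = 0 ∧
      (Pi.single (1 : Fin 3) ((s : ℝ) : UnitAddCircle) : UnitAddTorus (Fin 3)) 1 = s ∧
      (Pi.single (1 : Fin 3) ((s : ℝ) : UnitAddCircle) : UnitAddTorus (Fin 3)) 2 = 0 :=
  ⟨Pi.single_eq_of_ne (by decide) _, Pi.single_eq_same _ _, Pi.single_eq_of_ne (by decide) _⟩

/-- The Fourier coefficients of the zero function vanish. [folklore] -/
theorem mFourierCoeff_zero_fun {d : Type*} [Fintype d] (k : d → ℤ) :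
    UnitAddTorus.mFourierCoeff (0 : UnitAddTorus d → ℂ) k = 0 := by
  simp [UnitAddTorus.mFourierCoeff]

/-- **D5 — finite Fourier uniqueness on the circle**: if `Σ_{m ∈ T} γ_m e^{2πi m s} = 0` for every
real `s` then `γ_m = 0` for all `m ∈ T` (read the sum as a trigonometric polynomial on `T¹` and take
its Fourier coefficients, `Torus.mFourierCoeff_trigPoly`). [folklore] -/
theorem eq_zero_of_forall_sum_mul_exp_eq_zero (T : Finset ℤ) (γ : ℤ → ℂ)
    (h : ∀ s : ℝ, ∑ m ∈ T, γ m * Complex.exp (2 * Real.pi * Complex.I * m * s) = 0) :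
    ∀ m ∈ T, γ m = 0 := by
  classical
  intro m₀ hm₀
  set S : Finset (Fin 1 → ℤ) := T.image (fun m _ => m) with hS
  set c : (Fin 1 → ℤ) → ℂ := fun k => γ (k 0) with hc
  have hinj : ∀ m ∈ T, ∀ m' ∈ T, (fun _ : Fin 1 => m) = (fun _ : Fin 1 => m') → m = m' :=
    fun m _ m' _ hmm => congr_fun hmm 0
  have hzero : Torus.trigPoly S c = 0 := by
    funext x
    obtain ⟨s, hs⟩ : ∃ s : ℝ, ((s : ℝ) : UnitAddCircle) = x 0 := QuotientAddGroup.mk_surjective (x 0)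
    rw [Torus.trigPoly_apply, hS, Finset.sum_image hinj, Pi.zero_apply, ← h s]
    refine Finset.sum_congr rfl fun m _ => ?_
    rw [hc, smul_eq_mul, mul_comm]
    congr 1
    simp only [UnitAddTorus.mFourier, ContinuousMap.coe_mk, Fin.prod_univ_one]
    rw [← hs, fourier_coe_apply, Complex.ofReal_one, div_one]
  have hcoef := Torus.mFourierCoeff_trigPoly S c (fun _ => m₀)
  rw [hzero, mFourierCoeff_zero_fun] at hcoef
  have hmem : (fun _ : Fin 1 => m₀) ∈ S := by
    rw [hS, Finset.mem_image]
    exact ⟨m₀, hm₀, rfl⟩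
  rw [if_pos hmem] at hcoef
  exact hcoef.symm

/-- The same with the sum over a symmetric range `|m| ≤ D`. [folklore] -/
theorem eq_zero_of_forall_sum_Icc_mul_exp_eq_zero (D : ℕ) (γ : ℤ → ℂ)
    (h : ∀ s : ℝ, ∑ m ∈ Finset.Icc (-(D : ℤ)) D, γ m * Complex.exp (2 * Real.pi * Complex.I * m * s) = 0)
    {m : ℤ} (hm : |m| ≤ D) : γ m = 0 :=
  eq_zero_of_forall_sum_mul_exp_eq_zero _ γ h m (Finset.mem_Icc.2 (abs_le.1 hm))

end Axis

end

/-! ## Registered sub-goal (summary) -/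

/-- **Registered sub-goal `fourierDictionary_sum_mFourier_shearGrid` (summary of D7)**: below the
Nyquist frequency the character sum over the finite shear group `H_L` detects exactly the axial
frequencies: for `0 < L`, `|k₀| < L`, `|k₂| < L`,
`Σ_{j ∈ Fin L × Fin L} e_k(j₀/L, 0, j₂/L) = L²` if `k₀ = k₂ = 0` and `0` otherwise. [folklore] -/
theorem fourierDictionary_sum_mFourier_shearGrid : ∀ (L : ℕ) (k : Fin 3 → ℤ), 0 < L → |k 0| < L → |k 2| < L → ∑ j : Fin L × Fin L, (UnitAddTorus.mFourier k (fun i => ((((![(j.1 : ℕ), 0, (j.2 : ℕ)] : Fin 3 → ℕ) i : ℝ) / L : ℝ) : UnitAddCircle)) : ℂ) = if k 0 = 0 ∧ k 2 = 0 then ((L : ℂ)) ^ 2 else 0 :=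
  fun _ k hL h0 h2 => sum_mFourier_shearGrid_of_abs_lt hL k h0 h2

end Summit.AnomalousDissipation.AnomalousDissipation.Theorems.MomentParityQuarticGate
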